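import Literature.NumberTheory.EllipticCurves.EichlerIntegralFrickeProofs
import Mathlib.MeasureTheory.Integral.IntegralEqImproper
import HarnessLib

/-!
# KMV 2000 (21)–(22) at `k = 0`, proof file III: the head integral
# `∫_0^∞ f(iy) (∫_0^y f(iu) du) dy = (∫_0^∞ f(iy) dy)² / 2`
# (stub S3 of the fact skeleton `fricke-real-split` for `KMV2000.completedL_half_sq_eq`)

Source: E. Kowalski, P. Michel, J. VanderKam, J. reine angew. Math. 526 (2000), §5 p. 12,
(21)–(22) [held: paper:doi-10-1515-crll-2000-074]; the step itself is the fundamental theorem of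
calculus for `H²/2`, `H(y) = ∫_0^y f(iu) du` (no single source).
Cell landau-siegel / ls-inputs, seat ls-inputs-Hafe-w1 g0 (worker of ls-inputs-Hafe-lead, K-INPUTS-7 (3)).

## Content

* `KMV2000.integral_Ioi_mul_integral_Ioc_eq_sq_div_two` — for any `F : ℝ → ℂ` continuous and
  integrable on `(0, ∞)`: `∫_{y>0} F(y) · (∫_{0<u≤y} F(u) du) dy = (∫_{y>0} F)² / 2`.
  PROOF: `H(y) = ∫_{Ioc 0 y} F` is continuous on `[0, ∞)` with `H(0) = 0`, has derivative `F(y)`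
  at every `y > 0` (`intervalIntegral.integral_hasDerivAt_right`), is bounded by `‖F‖_{L¹}` and
  tends to `A = ∫_{y>0} F` (`intervalIntegral_tendsto_integral_Ioi`); so `Φ = H·H/2` has derivative
  `F·H`, which is integrable (integrable × bounded continuous), and
  `MeasureTheory.integral_Ioi_of_hasDerivAt_of_tendsto` gives `∫_{y>0} F·H = A·A/2 − Φ(0) = A²/2`.
* `KMV2000.integral_imagAxis_mul_head` — the case `F(y) = f(iy)`, `f ∈ S₂(Γ₀(N))`, any `N ≥ 1`
  (`integrableOn_imagAxis`, `continuousOn_imagAxis`), and its registered quantifier shape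
  `KMV2000.integral_mul_head_all` (stub S3 verbatim).

No named fact is used. No `L`-function, no moments; no claim about Landau–Siegel zeros.
-/

noncomputable section

open Complex Set MeasureTheory CongruenceSubgroup Filter
open _root_.Topology
open Literature.NumberTheory.EllipticCurves.ModularForms

namespace Literature.NumberTheory.LFunctions.KMV2000

/-- **FTC for `H²/2`.** If `F : ℝ → ℂ` is continuous and integrable on `(0, ∞)` and
`H(y) = ∫_{0 < u ≤ y} F(u) du`, then `∫_{y > 0} F(y) H(y) dy = (∫_{y > 0} F(y) dy)² / 2`
(`H' = F` on `(0, ∞)`, `H(0) = 0`, `H(y) → ∫_{y>0} F` as `y → ∞`, `H` bounded by `‖F‖_{L¹}`);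
the calculus step behind the `k = 0` case of KMV 2000 (21)–(22) in the real-variable (Fricke split)
form. [cite: KowalskiMichelVanderKam2000, §5 (21)–(22) p. 12 (k = 0, head integral)] -/
theorem integral_Ioi_mul_integral_Ioc_eq_sq_div_two {F : ℝ → ℂ}
    (hint : IntegrableOn F (Ioi 0)) (hcont : ContinuousOn F (Ioi 0)) :
    ∫ y in Ioi (0 : ℝ), F y * ∫ u in Ioc (0 : ℝ) y, F u = (∫ y in Ioi (0 : ℝ), F y) ^ 2 / 2 := by
  set G : ℝ → ℂ := fun y ↦ ∫ u in Ioc (0 : ℝ) y, F u with hG_def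
  set A : ℂ := ∫ y in Ioi (0 : ℝ), F y with hA_def
  -- `G` agrees with the interval primitive on `[0, ∞)`
  have hG_eq : ∀ y : ℝ, 0 ≤ y → G y = ∫ u in (0 : ℝ)..y, F u := fun y hy ↦ by
    rw [hG_def, intervalIntegral.integral_of_le hy]
  -- `G' = F` on `(0, ∞)`
  have hGd : ∀ y : ℝ, 0 < y → HasDerivAt G (F y) y := by
    intro y hy
    have hii : IntervalIntegrable F volume 0 y :=
      (intervalIntegrable_iff_integrableOn_Ioc_of_le hy.le).mpr (hint.mono_set Ioc_subset_Ioi_self)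
    have hmeas : StronglyMeasurableAtFilter F (𝓝 y) :=
      hcont.stronglyMeasurableAtFilter isOpen_Ioi y hy
    have hcy : ContinuousAt F y := hcont.continuousAt (Ioi_mem_nhds hy)
    refine (intervalIntegral.integral_hasDerivAt_right hii hmeas hcy).congr_of_eventuallyEq ?_
    filter_upwards [Ioi_mem_nhds hy] with y' hy'
    exact hG_eq y' (le_of_lt hy')
  -- `G` is bounded by `‖F‖_{L¹(0,∞)}`
  have hG_bound : ∀ y : ℝ, ‖G y‖ ≤ ∫ u in Ioi (0 : ℝ), ‖F u‖ := by
    intro y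
    calc ‖G y‖ ≤ ∫ u in Ioc (0 : ℝ) y, ‖F u‖ := norm_integral_le_integral_norm _
      _ ≤ ∫ u in Ioi (0 : ℝ), ‖F u‖ :=
          setIntegral_mono_set hint.norm (Eventually.of_forall fun _ ↦ norm_nonneg _)
            Ioc_subset_Ioi_self.eventuallyLE
  -- `G` is continuous from the right at `0`, with `G 0 = 0`
  have hG0 : G 0 = 0 := by
    simp only [hG_def, Ioc_self, Measure.restrict_empty, integral_zero_measure]
  have hGc0 : ContinuousWithinAt G (Ici 0) 0 := by
    have hIcc : IntegrableOn F (Icc (0 : ℝ) 1) := by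
      rw [integrableOn_Icc_iff_integrableOn_Ioc]
      exact hint.mono_set Ioc_subset_Ioi_self
    have h := intervalIntegral.continuousOn_primitive hIcc 0 (left_mem_Icc.mpr zero_le_one)
    exact h.mono_of_mem_nhdsWithin (Icc_mem_nhdsGE zero_lt_one)
  -- `G y → A` as `y → ∞`
  have hGlim : Tendsto G atTop (𝓝 A) := by
    have h := intervalIntegral_tendsto_integral_Ioi 0 hint tendsto_id
    refine h.congr' ?_
    filter_upwards [eventually_ge_atTop (0 : ℝ)] with y hy
    exact (hG_eq y hy).symm
  -- `Φ = G·G/2`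
  set Φ : ℝ → ℂ := fun y ↦ G y * G y / 2 with hΦ_def
  have hΦd : ∀ y ∈ Ioi (0 : ℝ), HasDerivAt Φ (F y * G y) y := by
    intro y hy
    refine (((hGd y hy).mul (hGd y hy)).div_const 2).congr_deriv ?_
    ring
  have hΦc0 : ContinuousWithinAt Φ (Ici 0) 0 := (hGc0.mul hGc0).div_const 2
  have hΦlim : Tendsto Φ atTop (𝓝 (A * A / 2)) := (hGlim.mul hGlim).div_const 2
  -- `F·G` is integrable on `(0, ∞)`: integrable × bounded continuous
  have hGm : AEStronglyMeasurable G (volume.restrict (Ioi (0 : ℝ))) :=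
    ContinuousOn.aestronglyMeasurable
      (fun y hy ↦ (hGd y hy).continuousAt.continuousWithinAt) measurableSet_Ioi
  have hFG : IntegrableOn (fun y ↦ F y * G y) (Ioi (0 : ℝ)) :=
    Integrable.mul_bdd hint hGm (Eventually.of_forall hG_bound)
  have hmain := integral_Ioi_of_hasDerivAt_of_tendsto hΦc0 hΦd hFG hΦlim
  rw [hmain]
  simp only [hΦ_def, hG0]
  ring

variable {N : ℕ} [NeZero N]

/-- **The head integral on the imaginary axis**: for `f ∈ S₂(Γ₀(N))` and `F(y) = f(iy)`,
`∫_0^∞ F(y) (∫_0^y F(u) du) dy = (∫_0^∞ F)² / 2` (FTC for `H²/2`; `F` is continuous and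
integrable on `(0, ∞)` by `continuousOn_imagAxis`, `integrableOn_imagAxis`).
[cite: KowalskiMichelVanderKam2000, §5 (21)–(22) p. 12 (k = 0, head integral)] -/
theorem integral_imagAxis_mul_head (f : CuspForm (Gamma0 N) 2) :
    ∫ y in Ioi (0 : ℝ), f (UpperHalfPlane.ofComplex (Complex.I * y)) *
        ∫ u in Ioc (0 : ℝ) y, f (UpperHalfPlane.ofComplex (Complex.I * u)) =
      (∫ y in Ioi (0 : ℝ), f (UpperHalfPlane.ofComplex (Complex.I * y))) ^ 2 / 2 :=
  integral_Ioi_mul_integral_Ioc_eq_sq_div_two (integrableOn_imagAxis f)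
    (continuousOn_imagAxis (CuspFormClass.holo f))

/-- Stub **S3** of the fact skeleton `fricke-real-split` (crux workfile
`Cruxes/BeyondDiagonalBeatsQuarter/Lines/fricke_real_split.lean` on stmt-Parity-20343), in its registered
quantifier shape: for every level `N ≥ 1` and every `f ∈ S₂(Γ₀(N))`,
`∫_0^∞ f(iy) (∫_0^y f(iu) du) dy = (∫_0^∞ f(iy) dy)² / 2`.
[cite: KowalskiMichelVanderKam2000, §5 (21)–(22) p. 12 (k = 0, head integral)] -/
theorem integral_mul_head_all :
    ∀ (N : ℕ) [NeZero N] (f : CuspForm (Gamma0 N) 2),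
      ∫ y in Ioi (0 : ℝ), f (UpperHalfPlane.ofComplex (Complex.I * y)) *
          ∫ u in Ioc (0 : ℝ) y, f (UpperHalfPlane.ofComplex (Complex.I * u)) =
        (∫ y in Ioi (0 : ℝ), f (UpperHalfPlane.ofComplex (Complex.I * y))) ^ 2 / 2 :=
  fun _ _ f ↦ integral_imagAxis_mul_head f

end Literature.NumberTheory.LFunctions.KMV2000

end
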